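import Summits.ABC.IUTFork.Conditional.AbcOfSOrNumKLevelCut
import Summits.ABC.IUTFork.LDHGenuineStepVSum
import Literature.IUT.LogVolume.GenuineLogThetaPointDegrees
import HarnessLib

/-!
# Branch C «abc ⇐ S»: the DEGREE CUT junctions — the CONE binder `hregC` and the NUM-1.10 binder `hSqMixC` of the books of record are VOID
# at every point with `d_mod = 1`, so each may carry the antecedent «`2 ≤ Cor22.dmod P`» (abc-iut cell, branch C, sequel «DEGREE CUT» to row
# «C-LEVELCUT-SHARP», junction file; seat abc-iut-C-cert-2 gen 7)

Record-only PROOF file (D-0012; 0 definitions, 0 `Prop` facts, nothing re-typed; binder texts VERBATIM as p460293 / p460539 / p461893 / p461892)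
of the abc-iut cell. TAKES NO SIDE on [IUTchIII] Cor. 3.12, on [IUTchIV] Thm. 1.10, on (U)/(P), or on any author.

The K and M books of record carry, next to their (U)-side binders, a CONE binder `hregC` («the hull estimate with print's `B_III(P,l)` at every
genuine datum that is NOT slot-constant», same text on both lines) and, in the stable companions, a NUM-1.10 binder `hSqMixC` («[IUTchIV]
Thm. 1.10 Step (viii)'s squeeze at the admissible points IN THE MIXING LOCUS», same text on both lines). Both antecedents are VOID at every
point with `d_mod = 1` (`F_mod = ℚ(j(λ)) = ℚ` has ONE place over each rational prime — abc-iut-c312-d1's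
`DHData.placesOver_subsingleton_of_finrank_eq_one` / `slotConstant_of_finrank_eq_one`, abc-iut-S-d2's `finrank_rat_fieldOfModuli_eq_dmod`):
every genuine datum is slot-constant, and the mixing witness `M = ∅` works (its bound reads `0 ≤ (l+1)/4·(0 + (20/3)·log(d*·l)·max(0, …))`).
Hence the two binder IMPLICATIONS (the cut binder implies the record's binder; data-free):

* **`DegCut.hregC_of_degCut`** — [CONE] `hregCD` (text VERBATIM + «`2 ≤ Cor22.dmod P →`») ⟹ `hregC`;
* **`DegCut.hSqMixC_of_degCut`** — [NUM-1.10] `hSqMixCD` ⟹ `hSqMixC`.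

WORDS (numbers, not adjectives): the CONE / NUM-1.10 binders are a `d_mod ≥ 2` affair — at every point of degree one (in particular at every
tabulated datum of the cell) they assume nothing (cf. abc-iut-s2-p5 `splitPair_vacuous_of_dmod_eq_one`; the records themselves already route
slot-constant data through abc-iut-S3/S1's pinned junction `PointDict.hullEstimateOf_BIII_pinned`). A cut discharges nothing; counts unchanged
in every book that uses these junctions. Typed ≠ proved; instantiated ≠ endorsed; no abc claim. [cite: Mochizuki2012, IUTchIV Thm. 1.10 p. 22–24,
Steps (v) p. 27–28, (viii) p. 30, Cor. 2.2 (ii) p. 44–46] [cite: DupuyHilado2025, §3.6, §4.12] [claim: Mochizuki2012, status: disputed] for every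
IUT quotation.
-/

noncomputable section

open Set Function NumberField IsDedekindDomain

namespace Summit.ABC.IUTFork.Conditional

open Thm311 Thm311.Real Cor312 Cor312Vol Cor312Prov Literature.IUT.LogThetaLattice Literature.IUT.LogVolume
  Literature.IUT.HodgeTheaters Literature.IUT.LogVolume.ThetaData Literature.IUT.LogVolume.Cor22
open Literature.NumberTheory.NumberFields Literature.NumberTheory.GaloisRepresentations.Ultrametric
open Literature.NumberTheory.DiophantineGeometry Literature.NumberTheory.DiophantineGeometry.GenEll Summit.ABC.ABC.Theorems
open scoped Classical

/-! ## §1. The two degree-cut junctions (data-free) -/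

/-- **[CONE] degree cut**: the hull-estimate binder demanded only at points with `d_mod ≥ 2` IMPLIES the record's `hregC` — at `d_mod = 1`
every genuine datum is slot-constant (`[F_mod(E_F) : ℚ] = d_mod = 1`, one place over each prime: `DHData.slotConstant_of_finrank_eq_one`), so
`hregC`'s antecedent «not slot-constant» is void there. [cite: Mochizuki2012, IUTchIV Thm. 1.10 Step (v) p. 27–28] [claim: Mochizuki2012, status: disputed] -/
theorem DegCut.hregC_of_degCut
    -- [CONE, CONTENT] the hull estimate with print's `B_III(P,l)` off the slot-constant regime, ONLY at admissible points ON the content locus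
    (hregCD : ∀ P : NFPoint, P ∈ UP → ∀ l : ℕ, l.Prime → 5 ≤ l →
      -- DEGREE CUT: ONLY at points with `d_mod ≥ 2` — at `d_mod = 1` (`F_mod = ℚ`: ONE place over each prime) every datum is slot-constant and no prime is mixed, so the antecedent below is void
      2 ≤ Cor22.dmod P →
      Cor22.AdmitsCore P → Cor22.CondP2 P l → Cor22.CondP5 P l → Cor22.CondP6 P l →
      6 * ((1 + 20 * (Cor22.dmod P : ℝ) / l) * (P.logDiff + Cor22.logCondAvoid P {2, l}))
          + 120 * (2 ^ 12 * 3 ^ 3 * 5 * (Cor22.dmod P : ℝ) * l) < Cor22.logQAvoid P {2, l} →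
      ∀ T : Cor22.ThetaVolumeDatumAt P l,
        (letI := T.instFieldF; letI := T.instNumberFieldF; letI := T.instAlgebraF; letI := T.instFieldK
         letI := T.instNumberFieldK; letI := T.instAlgebraK; letI := T.instFieldFbar; letI := T.instAlgebraFbar
         letI := T.instAlgebraKFbar; letI := T.instIsElliptic
         ¬ (∀ p ∈ T.I.supportPrimes, ∀ v w : placesOver (fieldOfModuli T.E) p,
            (Summit.ABC.IUTFork.DHData.ofInput T.I).logQloc p v = (Summit.ABC.IUTFork.DHData.ofInput T.I).logQloc p w)) →
        T.HullEstimateOf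
          (((l : ℝ) + 1) / 4 *
            ((1 + 12 * (Cor22.dmod P : ℝ) / l) * (P.logDiff + Cor22.logCondAvoid P {2, l})
              + 2 * Real.log l + 52
              + 20 / 3 * Real.log (((2 ^ 12 * 3 ^ 3 * 5 * Cor22.dmod P : ℕ) : ℝ) * (l : ℝ))
                * (Nat.primeCounting (2 ^ 12 * 3 ^ 3 * 5 * Cor22.dmod P * l) : ℝ)))) :
    ∀ P : NFPoint, P ∈ UP → ∀ l : ℕ, l.Prime → 5 ≤ l →
      Cor22.AdmitsCore P → Cor22.CondP2 P l → Cor22.CondP5 P l → Cor22.CondP6 P l →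
      6 * ((1 + 20 * (Cor22.dmod P : ℝ) / l) * (P.logDiff + Cor22.logCondAvoid P {2, l}))
          + 120 * (2 ^ 12 * 3 ^ 3 * 5 * (Cor22.dmod P : ℝ) * l) < Cor22.logQAvoid P {2, l} →
      ∀ T : Cor22.ThetaVolumeDatumAt P l,
        (letI := T.instFieldF; letI := T.instNumberFieldF; letI := T.instAlgebraF; letI := T.instFieldK
         letI := T.instNumberFieldK; letI := T.instAlgebraK; letI := T.instFieldFbar; letI := T.instAlgebraFbar
         letI := T.instAlgebraKFbar; letI := T.instIsElliptic
         ¬ (∀ p ∈ T.I.supportPrimes, ∀ v w : placesOver (fieldOfModuli T.E) p,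
            (Summit.ABC.IUTFork.DHData.ofInput T.I).logQloc p v = (Summit.ABC.IUTFork.DHData.ofInput T.I).logQloc p w)) →
        T.HullEstimateOf
          (((l : ℝ) + 1) / 4 *
            ((1 + 12 * (Cor22.dmod P : ℝ) / l) * (P.logDiff + Cor22.logCondAvoid P {2, l})
              + 2 * Real.log l + 52
              + 20 / 3 * Real.log (((2 ^ 12 * 3 ^ 3 * 5 * Cor22.dmod P : ℕ) : ℝ) * (l : ℝ))
                * (Nat.primeCounting (2 ^ 12 * 3 ^ 3 * 5 * Cor22.dmod P * l) : ℝ))) :=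
  fun P hP l hl h5 => by
    by_cases hd : Cor22.dmod P = 1
    · intro _ _ _ _ _ T hnc
      letI := T.instFieldF; letI := T.instNumberFieldF; letI := T.instAlgebraF; letI := T.instFieldK
      letI := T.instNumberFieldK; letI := T.instAlgebraK; letI := T.instFieldFbar; letI := T.instAlgebraFbar
      letI := T.instAlgebraKFbar; letI := T.instIsElliptic
      have hF : Module.finrank ℚ (fieldOfModuli T.E) = 1 := T.finrank_rat_fieldOfModuli_eq_dmod.trans hd
      exact (hnc fun p hp v w => by
        haveI : Fact p.Prime := ⟨T.I.prime_of_mem_supportPrimes hp⟩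
        exact DHData.slotConstant_of_finrank_eq_one hF (fun v => (Summit.ABC.IUTFork.DHData.ofInput T.I).logQloc p v) v w).elim
    · exact hregCD P hP l hl h5 (by have := Cor22.dmod_pos P; omega)

/-- **[NUM-1.10] degree cut**: the squeeze-in-the-mixing-locus binder demanded only at points with `d_mod ≥ 2` IMPLIES the record's `hSqMixC` —
at `d_mod = 1` the field `ℚ(j(λ))` has ONE place over each prime (`DHData.placesOver_subsingleton_of_finrank_eq_one`), so no prime is mixed and the
witness `M = ∅` puts the point OFF the mixing locus (`0 ≤ (l+1)/4·((20/3)·log(d*·l)·max(0,…))`). [cite: Mochizuki2012, IUTchIV Thm. 1.10 Step (viii)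
p. 30] [cite: DupuyHilado2025, §3.6] [claim: Mochizuki2012, status: disputed] -/
theorem DegCut.hSqMixC_of_degCut
    -- [NUM-1.10, content ∧ mixing] [IUTchIV] Thm 1.10 Step (viii)'s squeeze at the admissible points ON THE CONTENT LOCUS and IN the mixing locus
    -- (the negation of abc-iut-s2-p1's off-locus condition of `Conditional.hvol_offMixingLocus_holds`, VERBATIM)
    (hSqMixCD : ∀ P : NFPoint, P ∈ UP → ∀ l : ℕ, l.Prime → 5 ≤ l →
      -- DEGREE CUT: ONLY at points with `d_mod ≥ 2` — at `d_mod = 1` (`F_mod = ℚ`: ONE place over each prime) every datum is slot-constant and no prime is mixed, so the antecedent below is void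
      2 ≤ Cor22.dmod P →
      Cor22.AdmitsCore P → Cor22.CondP2 P l → Cor22.CondP5 P l → Cor22.CondP6 P l →
      6 * ((1 + 20 * (Cor22.dmod P : ℝ) / l) * (P.logDiff + Cor22.logCondAvoid P {2, l}))
          + 120 * (2 ^ 12 * 3 ^ 3 * 5 * (Cor22.dmod P : ℝ) * l) < Cor22.logQAvoid P {2, l} →
      ¬ (∃ M : Finset ℕ,
        (∀ p : ℕ, p.Prime →
          (¬ ∀ V W : HeightOneSpectrum (𝓞 ↥(IntermediateField.adjoin ℚ ({Cor22.jInv P.x} : Set P.F))),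
            V ∈ placesOver _ p → W ∈ placesOver _ p →
            (if ord _ V (Cor22.jMod P) < 0 ∧ ((2 : ℕ) : 𝓞 _) ∉ V.asIdeal ∧ ((l : ℕ) : 𝓞 _) ∉ V.asIdeal
              then ((-ord _ V (Cor22.jMod P) : ℤ) : ℝ) * logNorm _ V / (localDegree _ V : ℝ) else 0) =
            (if ord _ W (Cor22.jMod P) < 0 ∧ ((2 : ℕ) : 𝓞 _) ∉ W.asIdeal ∧ ((l : ℕ) : 𝓞 _) ∉ W.asIdeal
              then ((-ord _ W (Cor22.jMod P) : ℤ) : ℝ) * logNorm _ W / (localDegree _ W : ℝ) else 0)) → p ∈ M) ∧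
        ((l : ℝ) + 1) / 24 *
            ∑ p ∈ M, ∑ V : placesOver ↥(IntermediateField.adjoin ℚ ({Cor22.jInv P.x} : Set P.F)) p,
              (if ord _ V.1 (Cor22.jMod P) < 0 ∧ ((2 : ℕ) : 𝓞 _) ∉ V.1.asIdeal ∧ ((l : ℕ) : 𝓞 _) ∉ V.1.asIdeal then
                weight _ V.1 * (((-ord _ V.1 (Cor22.jMod P) : ℤ) : ℝ) * logNorm _ V.1 / (localDegree _ V.1 : ℝ))
               else 0) ≤
          ((l : ℝ) + 1) / 4 * (4 * ((Cor22.dmod P : ℝ) - 1) / l * (P.logDiff + Cor22.logCondAvoid P {2, l})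
            + 20 / 3 * Real.log (((2 ^ 12 * 3 ^ 3 * 5 * Cor22.dmod P : ℕ) : ℝ) * l)
              * max 0 (((Nat.primeCounting (2 ^ 12 * 3 ^ 3 * 5 * Cor22.dmod P * l) : ℝ)
                - (2 * (Cor22.dmod P : ℝ) * (P.logDiff + Cor22.logCondAvoid P {2, l}) + Real.log (2 * 3 * 5 * (l : ℝ)))
                  / Real.log 2)))) →
      (((l : ℝ) + 1) / 24 - 1 / (2 * l)) * Cor22.logQAvoid P {2, l} ≤
        ((l : ℝ) + 1) / 4 *
          ((1 + 12 * (Cor22.dmod P : ℝ) / l) * (P.logDiff + Cor22.logCondAvoid P {2, l})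
            + 2 * Real.log l + 52
            + 20 / 3 * Real.log (((2 ^ 12 * 3 ^ 3 * 5 * Cor22.dmod P : ℕ) : ℝ) * (l : ℝ))
              * (Nat.primeCounting (2 ^ 12 * 3 ^ 3 * 5 * Cor22.dmod P * l) : ℝ))
        + ThetaVolumeInput.archLogTheta l) :
    ∀ P : NFPoint, P ∈ UP → ∀ l : ℕ, l.Prime → 5 ≤ l →
      Cor22.AdmitsCore P → Cor22.CondP2 P l → Cor22.CondP5 P l → Cor22.CondP6 P l →
      6 * ((1 + 20 * (Cor22.dmod P : ℝ) / l) * (P.logDiff + Cor22.logCondAvoid P {2, l}))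
          + 120 * (2 ^ 12 * 3 ^ 3 * 5 * (Cor22.dmod P : ℝ) * l) < Cor22.logQAvoid P {2, l} →
      ¬ (∃ M : Finset ℕ,
        (∀ p : ℕ, p.Prime →
          (¬ ∀ V W : HeightOneSpectrum (𝓞 ↥(IntermediateField.adjoin ℚ ({Cor22.jInv P.x} : Set P.F))),
            V ∈ placesOver _ p → W ∈ placesOver _ p →
            (if ord _ V (Cor22.jMod P) < 0 ∧ ((2 : ℕ) : 𝓞 _) ∉ V.asIdeal ∧ ((l : ℕ) : 𝓞 _) ∉ V.asIdeal
              then ((-ord _ V (Cor22.jMod P) : ℤ) : ℝ) * logNorm _ V / (localDegree _ V : ℝ) else 0) =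
            (if ord _ W (Cor22.jMod P) < 0 ∧ ((2 : ℕ) : 𝓞 _) ∉ W.asIdeal ∧ ((l : ℕ) : 𝓞 _) ∉ W.asIdeal
              then ((-ord _ W (Cor22.jMod P) : ℤ) : ℝ) * logNorm _ W / (localDegree _ W : ℝ) else 0)) → p ∈ M) ∧
        ((l : ℝ) + 1) / 24 *
            ∑ p ∈ M, ∑ V : placesOver ↥(IntermediateField.adjoin ℚ ({Cor22.jInv P.x} : Set P.F)) p,
              (if ord _ V.1 (Cor22.jMod P) < 0 ∧ ((2 : ℕ) : 𝓞 _) ∉ V.1.asIdeal ∧ ((l : ℕ) : 𝓞 _) ∉ V.1.asIdeal then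
                weight _ V.1 * (((-ord _ V.1 (Cor22.jMod P) : ℤ) : ℝ) * logNorm _ V.1 / (localDegree _ V.1 : ℝ))
               else 0) ≤
          ((l : ℝ) + 1) / 4 * (4 * ((Cor22.dmod P : ℝ) - 1) / l * (P.logDiff + Cor22.logCondAvoid P {2, l})
            + 20 / 3 * Real.log (((2 ^ 12 * 3 ^ 3 * 5 * Cor22.dmod P : ℕ) : ℝ) * l)
              * max 0 (((Nat.primeCounting (2 ^ 12 * 3 ^ 3 * 5 * Cor22.dmod P * l) : ℝ)
                - (2 * (Cor22.dmod P : ℝ) * (P.logDiff + Cor22.logCondAvoid P {2, l}) + Real.log (2 * 3 * 5 * (l : ℝ)))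
                  / Real.log 2)))) →
      (((l : ℝ) + 1) / 24 - 1 / (2 * l)) * Cor22.logQAvoid P {2, l} ≤
        ((l : ℝ) + 1) / 4 *
          ((1 + 12 * (Cor22.dmod P : ℝ) / l) * (P.logDiff + Cor22.logCondAvoid P {2, l})
            + 2 * Real.log l + 52
            + 20 / 3 * Real.log (((2 ^ 12 * 3 ^ 3 * 5 * Cor22.dmod P : ℕ) : ℝ) * (l : ℝ))
              * (Nat.primeCounting (2 ^ 12 * 3 ^ 3 * 5 * Cor22.dmod P * l) : ℝ))
        + ThetaVolumeInput.archLogTheta l :=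
  fun P hP l hl h5 => by
    by_cases hd : Cor22.dmod P = 1
    · intro _ _ _ _ _ hnot
      have hF : Module.finrank ℚ ↥(IntermediateField.adjoin ℚ ({Cor22.jInv P.x} : Set P.F)) = 1 := hd
      refine (hnot ⟨∅, fun p hp hne => (hne fun V W hV hW => ?_).elim, ?_⟩).elim
      · haveI : Fact p.Prime := ⟨hp⟩
        have hVW : V = W := congrArg Subtype.val (DHData.placesOver_subsingleton_of_finrank_eq_one hF p ⟨V, hV⟩ ⟨W, hW⟩)
        subst hVW
        rfl
      · have hd' : (Cor22.dmod P : ℝ) = 1 := by exact_mod_cast hd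
        simp only [Finset.sum_empty, mul_zero, hd', sub_self, zero_div, zero_mul, zero_add]
        have h1 : (1 : ℝ) ≤ ((2 ^ 12 * 3 ^ 3 * 5 * Cor22.dmod P : ℕ) : ℝ) := by
          have : 1 ≤ 2 ^ 12 * 3 ^ 3 * 5 * Cor22.dmod P := by rw [hd]; norm_num
          exact_mod_cast this
        have h2 : (1 : ℝ) ≤ (l : ℝ) := by exact_mod_cast hl.one_lt.le
        have hlog : 0 ≤ Real.log (((2 ^ 12 * 3 ^ 3 * 5 * Cor22.dmod P : ℕ) : ℝ) * (l : ℝ)) := Real.log_nonneg (by nlinarith)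
        exact mul_nonneg (by positivity) (mul_nonneg (mul_nonneg (by norm_num) hlog) (le_max_left _ _))
    · exact hSqMixCD P hP l hl h5 (by have := Cor22.dmod_pos P; omega)

end Summit.ABC.IUTFork.Conditional

end
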